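/-
Copyright (c) 2026 the pub-hodgecm-mathlib formalisation cell (harness21).  Prover seat hodgecm-mathlib-LH4-p16 (g3) (K6 desk), req620 Track A «(D-RAM) FOUR-FRAME» squad
((β₂) road (R-36), the K6 road, WORD #25∕#26 piece (δ) «A1-D0»: the row's chart and label letters at GAP ZERO — the δ = 0 twin of ★ A1 p864708 `…RowInsideChartLetters` (this seat)
and of LH4-p15 (g3)'s A1-top `…RowTopChartLetters` (cand a87321ce, after LH4-p12 (g9) eb877444)), 2026-09-05.
-/
import Summits.HodgeConjecture.HodgeConjecture.Theorems.F0P3cDyRamRowInsideChartLetters      -- ★ A1 p864708 (this seat): `v_map_snd_eq` BY NAME; brings ★ p864373 `exists_refPair_of_frame`, ★ `exists_eq_map_add_map_mul_of_v_le_one`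
import Summits.HodgeConjecture.HodgeConjecture.Theorems.F0P3cDyRamAffineLabelGapZero          -- (this seat, (δ) §1): `exists_affineLabel_of_coords_gapZero` (the gap-zero dictionary, any parity)
import HarnessLib

/-!
# Crux `H413`, line LH4 «(D-RAM) FOUR-FRAME» — the (β₂) road (R-36), K6 road, piece (δ) «A1-D0»: «THE ROW'S GAP-ZERO CHART AND ITS LABEL LETTERS» — ONCE per live row
# `2b + d%2 = m` WITH GAP ZERO `jl = m` (the lone, diagonal cell `(b, b)` of an `N = 0` window of ‹CORE.v1› dd6c93c2 ∕ ‹CORE-ODD.v1› eff69f00)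

Cell `hodgecm-mathlib` (D-0151), FLOOR 0, crux item H413 = `stmt-HodgeConjecture-24833`, route of record `HCCMUnconditional`; squad F0∕P3c∕LH4; lane
`--supports stmt-HodgeConjecture-24833 --as helper` (count-neutral; pays NO tier-0 row).  THEOREMS ONLY (no `def`, no instance, no notation, no `sorry`, default heartbeats);
★-only imports; states NO law; (β₂) stays a HYPOTHESIS.  Hypotheses = ★ A1's ∕ A1-top's VERBATIM (sheet datum, `jE`-letters, `ρ`, `Θρ = ρΘ`, `α`, `|α − ρα| = 1`, the `M`-datum
`hDM`, `#𝓀[M] = q²`, `hσres`, `hτ`, the line `hm hjl`, the row `hbm : 2 * b + d % 2 = m`) with the window letters `{N} hN1 hNjl` REPLACED by the gap-zero letter `hjlm : jl = m`.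
THIS FILE, ONE theorem (interface `F0/P3c/LH4/LH4-p16/g3/A1-D0.interface.v1.LH4p16g3.lean.txt` 1285ddfe):
* HEAD `exists_rowDiagChart_letters_gapZero` — `∃ κ₀ ξ₀ μa μb R₀ γ₀ α₁ γ₁` with A1-top's conjuncts IN ORDER and FOUR byte deltas: `|ξ₀| = 1` (the reference pair at radius
  `exp 0`); `|μ_a + μ_bR₀| ≤ |ϖ|^m` — an INEQUALITY (at δ = 0 the `λ`-coordinate `|μ_bγ₀| = |ϖ|^m` is the main term, `|Â| ≤ 1 = |B̂|` in ★ p863973's words); `|α₁| ≤ 1` (and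
  `|γ₁| = 1`); and the dictionary's GUARD is the NX sphere `|μ_a + μ_b(R₀ + Wγ₀)| = |ϖ|^(2b + d%2)` itself (at δ = 0 it is exactly the non-X digit predicate `|α₁ + γ₁W| = 1`, by the
  two unit letters), the nearness clause keeping ★ F1b-top's bytes.
  Proof = A1-top's with ★ `exists_refPair_of_frame` at `n := 0`, the trace bound `|Tr_ρ(μκ₀)| ≤ |μ|` (three lines), ★ `v_map_snd_eq`, and (δ) §1 `exists_affineLabel_of_coords_gapZero`
  at `â′ := (μ_a + μ_bR₀)(ϖσϖ)^{−b}`, `b̂′ := μ_bγ₀(ϖσϖ)^{−b}`.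
CONSUMERS: (α) LH4-p12 (g10) `…RowDiagCellGapZeroPerCellValue.rowDiag_cellDiff_mul_card_eq_gapZero` (these conjuncts as binders), (γ) LH4-p15 (g3)'s δ = 0 top-cell composer, and the
desk's A6 `core_holds`∕`coreOdd_holds` at `W = 0`.  WHAT IS NOT CLAIMED: any count, any law.
HONEST LABEL.  Count-neutral valuation bookkeeping; nothing printed is asserted; no census law is stated; ‹D0›∕‹CORE›∕‹CORE-ODD›∕β₂ `stub_law_cleanSgn₂` UNPROVED; `HC_CM` is proved
only modulo the 7 printed citations (2 remaining named inputs: hLiu418 = `stmt-HodgeConjecture-24832`, h413 = `stmt-HodgeConjecture-24833`) until rung 0 closes.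
## References
* [Rogawski1990] J. D. Rogawski, *Automorphic Representations of Unitary Groups in Three Variables*, Ann. of Math. Stud. 123 (1990): §4.9 Prop. 4.9.1 (b) p. 55.
* [Serre1979] J.-P. Serre, *Local Fields*, GTM 67 (1979): Ch. I §6 Prop. 18; Ch. V §3 Cor. 3 pp. 85–87; Ch. XIV §2–§3.
* [Kottwitz1986BaseChangeUnits] R. E. Kottwitz, Compositio Math. 60 (1986): §1 pp. 240–241.
-/

set_option autoImplicit false

noncomputable section

namespace Summit.HodgeConjecture.HodgeConjecture.Cruxes.H413.F0P3cDyRamRowDiagChartLettersGapZero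

open scoped Valued WithZero
open WithZero
open Literature.NumberTheory.Automorphic.UnitaryThreeFourFrame (IsRamifiedQuadraticDatum normSign)
open Summit.HodgeConjecture.HodgeConjecture.Cruxes.H413.F0P3cDyRamFourFramePieces (mstarOfRecord)
open Summit.HodgeConjecture.HodgeConjecture.Cruxes.H413.F0P3cDyRamRamKFrameClassLetters (exists_refPair_of_frame)
open Summit.HodgeConjecture.HodgeConjecture.Cruxes.H413.F0P3cDyRamConeCellCleanRegimeBoundary (exists_eq_map_add_map_mul_of_v_le_one)
open Summit.HodgeConjecture.HodgeConjecture.Cruxes.H413.F0P3cDyRamAffineLabelGapZero (exists_affineLabel_of_coords_gapZero)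
open Summit.HodgeConjecture.HodgeConjecture.Cruxes.H413.F0P3cDyRamRowInsideChartLetters (v_map_snd_eq)

variable {E M : Type} [Field E] [Valued E ℤᵐ⁰] [Field M] [Valued M ℤᵐ⁰] {ρ Θ : M →+* M} {α : M}

/-- **HEAD — «THE ROW'S GAP-ZERO CHART AND ITS LABEL LETTERS».**  In the CORE letters' frame (★ A1's hypotheses VERBATIM), for the live row `2b + d%2 = m` at GAP ZERO `jl = m`:
a reference pair `(κ₀, ξ₀) ⊂ Fix Θ` of the line `Tr_ρ = 1` with `|κ₀| = 1`, `ρξ₀ = −ξ₀`, `|ξ₀| = 1` (`|ξ₀|·|jEϖ|^{jl} = |jEϖ|^{2b+d%2}`), coordinates `μ = jE μ_a + jE μ_b α`,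
`jE R₀ = Tr_ρ(ακ₀)`, `jE γ₀ = ξ₀(α − ρα)` with `|μ_a + μ_bR₀| ≤ |ϖ|^m` and `|μ_bγ₀| = |ϖ|^m` (the `λ`-coordinate is the main term), `σ`-fixed `α₁, γ₁` with `|α₁| ≤ 1`, `|γ₁| = 1`,
the two UNIT LETTERS (the NX sphere `|μ_a + μ_b(R₀ + Vγ₀)| = |ϖ|^{2b+d%2}` IS the non-X digit set `|α₁ + γ₁V| = 1`) and the affine-sign dictionary guarded by the NX sphere.
[cite: Rogawski1990, §4.9 Prop. 4.9.1 (b) p. 55] [cite: Serre1979, Ch. V §3 Cor. 3 pp. 85–87] [cite: Serre1979, Ch. XIV §2–§3] -/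
theorem exists_rowDiagChart_letters_gapZero [CompleteSpace E] [Finite 𝓀[E]] [CompleteSpace M] [Finite 𝓀[M]]
    {σ : E →+* E} {ϖ : E} {d tE : ℕ} (hD : IsRamifiedQuadraticDatum σ ϖ d tE)
    (jE : E →+* M) (hjiso : ∀ a, Valued.v (jE a) = Valued.v a) (hjfix : ∀ z, ρ z = z ↔ ∃ c, jE c = z) (hΘj : ∀ c, Θ (jE c) = jE (σ c))
    (hρρ : ∀ x, ρ (ρ x) = x) (hvρ : ∀ x, Valued.v (ρ x) = Valued.v x) (hΘρ : ∀ x, Θ (ρ x) = ρ (Θ x))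
    (hα : ρ α ≠ α) (hα1 : Valued.v α ≤ 1) (hint : ∀ z : M, Valued.v z ≤ 1 → Valued.v ((z - ρ z) / (α - ρ α)) ≤ 1)
    (hU : Valued.v (α - ρ α) = 1) (hDM : IsRamifiedQuadraticDatum Θ (jE ϖ) d tE)
    {q : ℕ} (hq : Nat.card 𝓀[M] = q ^ 2)
    (hσres : ∀ z : M, ρ z = z → Valued.v z ≤ 1 → Valued.v (Θ z - z) < 1) (hτ : Valued.v (α - Θ α) < 1)
    (lam : M) (u00 : E) {m jl : ℕ} (hm : Valued.v (lam - jE u00) = exp (-(m : ℤ)))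
    (hjl : Valued.v ((lam - jE u00) - ρ (lam - jE u00)) = exp (-(jl : ℤ)))
    {b : ℕ} (hbm : 2 * b + d % 2 = m) (hjlm : jl = m) :
    ∃ (κ₀ ξ₀ : M) (μa μb R₀ γ₀ α₁ γ₁ : E),
      κ₀ + ρ κ₀ = 1 ∧ Θ κ₀ = κ₀ ∧ Valued.v κ₀ ≤ 1 ∧ Valued.v κ₀ = 1 ∧ ρ ξ₀ = -ξ₀ ∧ Θ ξ₀ = ξ₀ ∧ ξ₀ ≠ 0 ∧
      Valued.v ξ₀ = 1 ∧ Valued.v ξ₀ * Valued.v (jE ϖ) ^ jl = Valued.v (jE ϖ) ^ (2 * b + d % 2) ∧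
      lam - jE u00 = jE μa + jE μb * α ∧ jE R₀ = α * κ₀ + ρ (α * κ₀) ∧ jE γ₀ = ξ₀ * (α - ρ α) ∧
      Valued.v (μa + μb * R₀) ≤ Valued.v ϖ ^ m ∧ Valued.v (μb * γ₀) = Valued.v ϖ ^ m ∧
      σ α₁ = α₁ ∧ Valued.v α₁ ≤ 1 ∧ σ γ₁ = γ₁ ∧ Valued.v γ₁ = 1 ∧ Valued.v γ₁ ≤ 1 ∧
      (∀ V : E, σ V = V → Valued.v V ≤ 1 → Valued.v (μa + μb * (R₀ + V * γ₀)) = Valued.v ϖ ^ (2 * b + d % 2) → Valued.v (α₁ + γ₁ * V) = 1) ∧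
      (∀ V : E, σ V = V → Valued.v V ≤ 1 → Valued.v (α₁ + γ₁ * V) = 1 → Valued.v (μa + μb * (R₀ + V * γ₀)) = Valued.v ϖ ^ (2 * b + d % 2)) ∧
      ∀ (T W f : E), σ T = T → Valued.v T = 1 → σ W = W → Valued.v W ≤ 1 → σ f = f →
        Valued.v (μa + μb * (R₀ + W * γ₀)) = Valued.v ϖ ^ (2 * b + d % 2) →
        Valued.v (T * ((μa + μb * R₀) * ((ϖ * σ ϖ) ^ b)⁻¹ + μb * γ₀ * ((ϖ * σ ϖ) ^ b)⁻¹ * W) - f * ((ϖ - σ ϖ) * ((ϖ * σ ϖ) ^ ((d - d % 2) / 2))⁻¹)) ≤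
          Valued.v ϖ ^ mstarOfRecord d → normSign σ f = normSign σ T * normSign σ (α₁ + γ₁ * W) := by
  -- adapted from LH4-p15 (g3)'s A1-top `exists_rowTopChart_letters` (cand a87321ce, after LH4-p12 (g9) eb877444) at `N := 0`
  obtain ⟨hσσ, hvσ, hϖ, -, -, -, -⟩ := id hD
  have hρj : ∀ c : E, ρ (jE c) = jE c := fun c => (hjfix _).2 ⟨c, rfl⟩
  have hϖ0 : ϖ ≠ 0 := fun h0 => by rw [h0, map_zero] at hϖ; exact (exp_ne_zero hϖ.symm).elim
  have hvϖ0 : Valued.v ϖ ≠ 0 := by rw [hϖ]; exact exp_ne_zero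
  have hϖn : ∀ n : ℕ, Valued.v ϖ ^ n = exp (-(n : ℤ)) := fun n => by rw [hϖ, ← exp_nsmul, nsmul_eq_mul, mul_neg, mul_one]
  have hπn : ∀ n : ℕ, Valued.v (jE ϖ) ^ n = exp (-(n : ℤ)) := fun n => by rw [hjiso, hϖn]
  -- the reference pair of radius `exp 0 = 1`
  obtain ⟨κ₀, ξ₀, hκ₀, hΘκ₀, hξ, hΘξ, hξ0, hκ₀1, hξv⟩ :=
    exists_refPair_of_frame hD jE hjiso hjfix hΘj hρρ hvρ hΘρ hα1 hU hDM hq hσres hτ 0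
  have hξ1 : Valued.v ξ₀ = 1 := by rw [hξv, Nat.cast_zero, mul_zero, exp_zero]
  -- a trace-one element has size at least `1`, hence `|κ₀| = 1`
  have hκ₀v : Valued.v κ₀ = 1 := by
    have h := Valuation.map_add Valued.v κ₀ (ρ κ₀)
    rw [hκ₀, Valuation.map_one, hvρ, max_self] at h
    exact le_antisymm hκ₀1 h
  -- the `(1, α)`-coordinates of `μ`
  set μ : M := lam - jE u00 with hμ
  have hμ1 : Valued.v μ ≤ 1 := by rw [hm, ← exp_zero]; exact exp_le_exp.2 (by omega)
  obtain ⟨μa, μb, -, -, hμab⟩ := exists_eq_map_add_map_mul_of_v_le_one hρρ hα hα1 hint jE hjfix hμ1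
  -- `R₀`, `γ₀` by pull-back along `Fix ρ = jE(E)`
  obtain ⟨R₀, hR₀⟩ := (hjfix (α * κ₀ + ρ (α * κ₀))).1 (by rw [map_add, hρρ, add_comm])
  obtain ⟨γ₀, hγ₀⟩ := (hjfix (ξ₀ * (α - ρ α))).1 (by rw [map_mul, hξ, map_sub, hρρ]; ring)
  -- SIZE 1 (an INEQUALITY at gap zero): `|μa + μb R₀| = |Tr_ρ(μκ₀)| ≤ |μ| = exp(−m)`
  have hâE : jE (μa + μb * R₀) = μ * κ₀ + ρ (μ * κ₀) := by
    have hρκ : ρ κ₀ = 1 - κ₀ := by rw [← hκ₀]; ring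
    rw [map_add, map_mul, hR₀, hμab]
    simp only [map_add, map_mul, hρj, hρκ]
    ring
  have hâle : Valued.v (μa + μb * R₀) ≤ Valued.v ϖ ^ m := by
    rw [← hjiso, hâE, hϖn, ← hm]
    refine (Valuation.map_add _ _ _).trans (max_le ?_ ?_)
    · rw [Valuation.map_mul]; exact mul_le_of_le_one_right' hκ₀1
    · rw [hvρ, Valuation.map_mul]; exact mul_le_of_le_one_right' hκ₀1
  -- SIZE 2: `|μb γ₀| = |μ − ρμ|·|ξ₀| = exp(−jl) = exp(−m)` — at gap zero the digit term is THE main term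
  have hbv : Valued.v (μb * γ₀) = Valued.v ϖ ^ m := by
    rw [← hjiso, map_mul, Valuation.map_mul, v_map_snd_eq jE hρj hU hμab, hjl, hγ₀, Valuation.map_mul, hU, mul_one, hξ1, mul_one, hϖn, hjlm]
  -- the chart identity `|ξ₀|·|jEϖ|^jl = |jEϖ|^m = |jEϖ|^(2b + d%2)`
  have hξjl : Valued.v ξ₀ * Valued.v (jE ϖ) ^ jl = Valued.v (jE ϖ) ^ (2 * b + d % 2) := by rw [hξ1, one_mul, hjlm, hbm]
  -- the gap-zero dictionary ((δ) §1) at the normalised coordinates `â′ := (μa + μbR₀)·P⁻¹`, `b̂′ := μbγ₀·P⁻¹`, `P = (ϖσϖ)^b`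
  have hPv : Valued.v ((ϖ * σ ϖ) ^ b) = Valued.v ϖ ^ (2 * b) := by rw [Valuation.map_pow, Valuation.map_mul, hvσ, ← pow_two, ← pow_mul, mul_comm]
  have hP0 : (ϖ * σ ϖ) ^ b ≠ 0 := pow_ne_zero _ (mul_ne_zero hϖ0 (by rw [ne_eq, map_eq_zero_iff σ σ.injective]; exact hϖ0))
  have hPv0 : Valued.v ((ϖ * σ ϖ) ^ b) ≠ 0 := (Valuation.ne_zero_iff _).2 hP0
  have hPinv0 : Valued.v (((ϖ * σ ϖ) ^ b)⁻¹) ≠ 0 := by rw [map_inv₀]; exact inv_ne_zero hPv0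
  have hâ' : Valued.v ((μa + μb * R₀) * ((ϖ * σ ϖ) ^ b)⁻¹) ≤ Valued.v ϖ ^ (d % 2) := by
    rw [Valuation.map_mul, map_inv₀, hPv, ← div_eq_mul_inv, div_le_iff₀ (pow_pos (zero_lt_iff.2 hvϖ0) _), ← pow_add, show d % 2 + 2 * b = m by omega]
    exact hâle
  have hbh' : Valued.v (μb * γ₀ * ((ϖ * σ ϖ) ^ b)⁻¹) = Valued.v ϖ ^ (d % 2) := by
    rw [Valuation.map_mul, map_inv₀, hbv, hPv, ← hbm, pow_add, mul_comm (Valued.v ϖ ^ (2 * b)), mul_assoc, mul_inv_cancel₀ (by rwa [hPv] at hPv0), mul_one]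
  obtain ⟨α₁, γ₁, hα₁σ, hα₁1, hγ₁σ, hγ₁v, hiff, haff⟩ := exists_affineLabel_of_coords_gapZero hD hâ' hbh'
  -- the NX sphere in the socket's currency: `|μa + μb(R₀ + Vγ₀)| = |ϖ|^(2b + d%2)` ↔ `|â′ + b̂′V| = |b̂′|`
  have hshell : ∀ V : E, Valued.v (μa + μb * (R₀ + V * γ₀)) = Valued.v ϖ ^ (2 * b + d % 2) ↔
      Valued.v ((μa + μb * R₀) * ((ϖ * σ ϖ) ^ b)⁻¹ + μb * γ₀ * ((ϖ * σ ϖ) ^ b)⁻¹ * V) = Valued.v (μb * γ₀ * ((ϖ * σ ϖ) ^ b)⁻¹) := by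
    intro V
    have e : (μa + μb * R₀) * ((ϖ * σ ϖ) ^ b)⁻¹ + μb * γ₀ * ((ϖ * σ ϖ) ^ b)⁻¹ * V = (μa + μb * (R₀ + V * γ₀)) * ((ϖ * σ ϖ) ^ b)⁻¹ := by ring
    rw [e, Valuation.map_mul, Valuation.map_mul _ (μb * γ₀), hbv, hbm]
    exact ⟨fun h => by rw [h], fun h => mul_right_cancel₀ hPinv0 h⟩
  have hunit' : ∀ V : E, σ V = V → Valued.v V ≤ 1 → Valued.v (μa + μb * (R₀ + V * γ₀)) = Valued.v ϖ ^ (2 * b + d % 2) →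
      Valued.v (α₁ + γ₁ * V) = 1 := fun V hσV hV1 hNX => (hiff V hσV hV1).1 ((hshell V).1 hNX)
  have hconv : ∀ V : E, σ V = V → Valued.v V ≤ 1 → Valued.v (α₁ + γ₁ * V) = 1 →
      Valued.v (μa + μb * (R₀ + V * γ₀)) = Valued.v ϖ ^ (2 * b + d % 2) := fun V hσV hV1 hU1 => (hshell V).2 ((hiff V hσV hV1).2 hU1)
  exact ⟨κ₀, ξ₀, μa, μb, R₀, γ₀, α₁, γ₁, hκ₀, hΘκ₀, hκ₀1, hκ₀v, hξ, hΘξ, hξ0, hξ1, hξjl, hμab, hR₀, hγ₀, hâle, hbv, hα₁σ, hα₁1, hγ₁σ, hγ₁v, hγ₁v.le,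
    hunit', hconv, fun T W f hσT hT1 hσW hW1 hσf hNX hnear => haff T W f hσT hT1 hσW hW1 hσf ((hshell W).1 hNX) hnear⟩

end Summit.HodgeConjecture.HodgeConjecture.Cruxes.H413.F0P3cDyRamRowDiagChartLettersGapZero

end
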